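import Literature.MathematicalPhysics.QuantumFieldTheory.Balaban1983to89.BlockAveragingEMLLinearisedBackground
import HarnessLib

/-!
# Route `UnitScaleTilt`, crux K1 «MinimiserStabilityRegPr» (stmt-QuantumFields-19200), route-R E′ (A′) «HCOW-VIA-Σ», row P-A2 «JOINT-Σ», file F3″-B2b —
# THE RELATIVE HOLONOMY IN LOCAL `ℓ¹` CURRENCY: `‖U(Γ)·U₀(Γ)* − 1‖ ≤ (1+δ)^{|Γ|}·Σ_{s ∈ Γ} ‖Y_{b_s}‖`

Cell `ym3-torus`, width seat `ym3-torus-px22` (gen 3); ★p1 g17 WORD 10 (4) «F3″ → px22»; LOCATE `LOCATE-PA2-F3-LEVELMASSES-px22g3.md` §2.  THE POINT.  ✓ `BlockAveragingEMLLinearisedBackground.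
norm_holRatio_bounds` bounds the relative holonomy `D(Γ) = U(Γ)U₀(Γ)* − 1` by the SUP: `(1+δ)^m − 1`.  The `ℓ²` bookkeeping of the accumulated-frame recursion (✓ `Prop7AccumulatedFrameStep.
norm_frameAccU_succ_sub_one_le`'s stair term `‖R_i − 1‖`) needs the LOCAL `ℓ¹` form: the same recursion `D(s·Γ) = Z_s + g_sD(Γ)g_s* + Z_s·g_sD(Γ)g_s*` with the exact step bound
`‖Z_s‖ ≤ ‖Y_{b_s}‖` (forward `Z_s = Y_b`; backward `Z_s = g_s((1+Y_b)* − 1)g_s*`, `‖(1+Y_b)* − 1‖ = ‖Y_b‖` by unitarity) gives `‖D(Γ)‖ ≤ (1+δ)^{|Γ|}·Σ_{s∈Γ}‖Y_{b_s}‖` — the sup `δ` only as a FACTOR,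
the walk sum LOCAL (so its square sums over the blocks to the single-bar level mass).  THEOREMS ONLY (0 `def`, 0 `sorry`); `--supports stmt-QuantumFields-19200`, count-neutral.
YM₃ on T³ is a ladder rung (R3), not the Clay problem; nothing here claims the stub, the crux, d = 4 or the gap.

References: T. Bałaban, CMP 98 (1985) 17–51 [Balaban1985Averaging] ((56)–(58) p.27, (122)–(123) p.36).
-/

set_option autoImplicit false

noncomputable section

open scoped BigOperators Matrix.Norms.L2Operator

namespace Summit.QuantumFields.YangMills.Theorems.Prop7HolRatioWalkSum

open Literature.MathematicalPhysics.QuantumFieldTheory.Balaban1983to89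
open T4Continuum BlockAveraging
open BlockAveragingEMLLinearised (stepFactor coe_holAt_eq_prod_stepFactor)
open BlockAveragingEMLLinearisedBackground (pertVar pertVar_eq stepFactor_mul_star_stepFactor norm_holRatio_bounds)

variable {n : Type*} [Fintype n] [DecidableEq n] {P : Params} {j : ℕ}

/-- Elements of `SU(N)` are unitary matrices (local copy). [folklore] -/
private theorem coe_mem_unitaryGroup (g : Matrix.specialUnitaryGroup n ℂ) : (g : Matrix n n ℂ) ∈ Matrix.unitaryGroup n ℂ :=
  (Matrix.mem_specialUnitaryGroup_iff.1 g.2).1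

/-- `g*·g = 1` (local copy). [folklore] -/
private theorem coe_star_mul_self (g : Matrix.specialUnitaryGroup n ℂ) : star (g : Matrix n n ℂ) * (g : Matrix n n ℂ) = 1 :=
  Unitary.star_mul_self_of_mem (coe_mem_unitaryGroup g)

/-- `g·g* = 1` (local copy). [folklore] -/
private theorem coe_mul_star_self (g : Matrix.specialUnitaryGroup n ℂ) : (g : Matrix n n ℂ) * star (g : Matrix n n ℂ) = 1 :=
  Unitary.mul_star_self_of_mem (coe_mem_unitaryGroup g)

variable [Nonempty n]

/-- `‖g‖ = 1` (local copy). [folklore] -/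
private theorem norm_coe_eq_one (g : Matrix.specialUnitaryGroup n ℂ) : ‖(g : Matrix n n ℂ)‖ = 1 :=
  CStarRing.norm_of_mem_unitary (coe_mem_unitaryGroup g)

/-- `‖g*‖ = 1` (local copy). [folklore] -/
private theorem norm_star_coe_eq_one (g : Matrix.specialUnitaryGroup n ℂ) : ‖star (g : Matrix n n ℂ)‖ = 1 := by
  rw [norm_star]; exact norm_coe_eq_one g

omit [Nonempty n] in
/-- `g_s·g_s* = 1` for the background step factor (local copy). [folklore] -/
private theorem stepFactor_mul_star (U₀ : GaugeField P j (Matrix.specialUnitaryGroup n ℂ)) (s : LStep P j) :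
    stepFactor U₀ s * star (stepFactor U₀ s) = 1 := by
  unfold stepFactor
  cases s.fwd
  · simp only [Bool.false_eq_true, ↓reduceIte, star_star]; exact coe_star_mul_self _
  · simp only [↓reduceIte]; exact coe_mul_star_self _

omit [Nonempty n] in
/-- `g_s*·g_s = 1` (local copy). [folklore] -/
private theorem star_mul_stepFactor (U₀ : GaugeField P j (Matrix.specialUnitaryGroup n ℂ)) (s : LStep P j) :
    star (stepFactor U₀ s) * stepFactor U₀ s = 1 := by
  unfold stepFactor
  cases s.fwd
  · simp only [Bool.false_eq_true, ↓reduceIte, star_star]; exact coe_mul_star_self _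
  · simp only [↓reduceIte]; exact coe_star_mul_self _

/-- `‖g_s‖ = 1` and `‖g_s*‖ = 1` (local copy). [folklore] -/
private theorem norm_stepFactor_and_star (U₀ : GaugeField P j (Matrix.specialUnitaryGroup n ℂ)) (s : LStep P j) :
    ‖stepFactor U₀ s‖ = 1 ∧ ‖star (stepFactor U₀ s)‖ = 1 := by
  unfold stepFactor
  cases s.fwd
  · simp only [Bool.false_eq_true, ↓reduceIte, star_star]; exact ⟨norm_star_coe_eq_one _, norm_coe_eq_one _⟩
  · simp only [↓reduceIte]; exact ⟨norm_coe_eq_one _, norm_star_coe_eq_one _⟩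

/-- `‖g_s X g_s*‖ ≤ ‖X‖` (local copy). [folklore] -/
private theorem norm_conj_stepFactor_le (U₀ : GaugeField P j (Matrix.specialUnitaryGroup n ℂ)) (s : LStep P j) (X : Matrix n n ℂ) :
    ‖stepFactor U₀ s * X * star (stepFactor U₀ s)‖ ≤ ‖X‖ := by
  obtain ⟨h1, h2⟩ := norm_stepFactor_and_star U₀ s
  calc _ ≤ ‖stepFactor U₀ s‖ * ‖X‖ * ‖star (stepFactor U₀ s)‖ := (norm_mul_le _ _).trans (mul_le_mul_of_nonneg_right (norm_mul_le _ _) (norm_nonneg _))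
    _ = ‖X‖ := by rw [h1, h2, one_mul, mul_one]

/-- `‖(1+Y_b)* − 1‖ = ‖Y_b‖`: `1 + Y_b = U_bU₀,b⁻¹ ∈ SU(N)`, and `‖h* − 1‖ = ‖h⁻¹ − 1‖ = ‖h − 1‖` for unitary `h` (`h⁻¹ − 1 = −h*(h − 1)`). [folklore] -/
private theorem norm_star_one_add_pertVar_sub_one (U₀ U : GaugeField P j (Matrix.specialUnitaryGroup n ℂ)) (b : PBond P j) :
    ‖star (1 + pertVar U₀ U b) - 1‖ = ‖pertVar U₀ U b‖ := by
  have h1 : (1 : Matrix n n ℂ) + pertVar U₀ U b = ((U b * (U₀ b)⁻¹ : Matrix.specialUnitaryGroup n ℂ) : Matrix n n ℂ) := by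
    rw [pertVar]; abel
  set h : Matrix.specialUnitaryGroup n ℂ := U b * (U₀ b)⁻¹ with hh
  have hY : pertVar U₀ U b = (h : Matrix n n ℂ) - 1 := by rw [pertVar]
  rw [h1, hY]
  have e : star (h : Matrix n n ℂ) - 1 = -(star (h : Matrix n n ℂ) * ((h : Matrix n n ℂ) - 1)) := by
    rw [mul_sub, coe_star_mul_self, mul_one]; abel
  rw [e, norm_neg]
  apply le_antisymm
  · calc ‖star (h : Matrix n n ℂ) * ((h : Matrix n n ℂ) - 1)‖ ≤ ‖star (h : Matrix n n ℂ)‖ * ‖(h : Matrix n n ℂ) - 1‖ := norm_mul_le _ _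
      _ = ‖(h : Matrix n n ℂ) - 1‖ := by rw [norm_star_coe_eq_one, one_mul]
  · have e2 : (h : Matrix n n ℂ) - 1 = (h : Matrix n n ℂ) * (star (h : Matrix n n ℂ) * ((h : Matrix n n ℂ) - 1)) := by
      rw [← mul_assoc, coe_mul_star_self, one_mul]
    calc ‖(h : Matrix n n ℂ) - 1‖ = ‖(h : Matrix n n ℂ) * (star (h : Matrix n n ℂ) * ((h : Matrix n n ℂ) - 1))‖ := by rw [← e2]
      _ ≤ ‖(h : Matrix n n ℂ)‖ * ‖star (h : Matrix n n ℂ) * ((h : Matrix n n ℂ) - 1)‖ := norm_mul_le _ _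
      _ = ‖star (h : Matrix n n ℂ) * ((h : Matrix n n ℂ) - 1)‖ := by rw [norm_coe_eq_one, one_mul]

/-- ★★★ **THE RELATIVE HOLONOMY, LOCAL `ℓ¹` FORM**: with `Y = pertVar U₀ U`, `‖Y_b‖ ≤ δ` on every bond (`0 ≤ δ`), for every walk `Γ`
`‖U(Γ)·U₀(Γ)* − 1‖ ≤ (1+δ)^{|Γ|} · Σ_{s ∈ Γ} ‖Y_{b_s}‖` — the sup enters only as the factor `(1+δ)^{|Γ|}`, the walk sum is local. [cite: Balaban1985Averaging, (56)-(58) p.27, (122)-(123) p.36] -/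
theorem norm_holRatio_sub_one_le_walkSum (U₀ U : GaugeField P j (Matrix.specialUnitaryGroup n ℂ)) {δ : ℝ} (hδ : 0 ≤ δ)
    (hY : ∀ b, ‖pertVar U₀ U b‖ ≤ δ) :
    ∀ γ : List (LStep P j),
      ‖((holAt U γ : Matrix.specialUnitaryGroup n ℂ) : Matrix n n ℂ) * star ((holAt U₀ γ : Matrix.specialUnitaryGroup n ℂ) : Matrix n n ℂ) - 1‖
        ≤ (1 + δ) ^ γ.length * (γ.map fun s => ‖pertVar U₀ U s.bond‖).sum
  | [] => by simp [holAt_nil]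
  | s :: γ => by
    have ih := norm_holRatio_sub_one_le_walkSum U₀ U hδ hY γ
    have ih₀ := (norm_holRatio_bounds U₀ U hδ hY γ).1
    -- letters
    set F : Matrix n n ℂ := ((holAt U γ : Matrix.specialUnitaryGroup n ℂ) : Matrix n n ℂ) with hF
    set F₀ : Matrix n n ℂ := ((holAt U₀ γ : Matrix.specialUnitaryGroup n ℂ) : Matrix n n ℂ) with hF₀
    set f : Matrix n n ℂ := stepFactor U s with hf
    set g : Matrix n n ℂ := stepFactor U₀ s with hg
    set D : Matrix n n ℂ := F * star F₀ - 1 with hD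
    set S : ℝ := (γ.map fun s => ‖pertVar U₀ U s.bond‖).sum with hS
    set Z : Matrix n n ℂ := f * star g - 1 with hZ
    have hgg : g * star g = 1 := stepFactor_mul_star U₀ s
    have hgg' : star g * g = 1 := star_mul_stepFactor U₀ s
    -- the exact step bound `‖Z‖ ≤ ‖Y_{b_s}‖`
    have hZle : ‖Z‖ ≤ ‖pertVar U₀ U s.bond‖ := by
      have hfg := stepFactor_mul_star_stepFactor U₀ U s
      rw [← hf, ← hg] at hfg
      revert hfg
      cases s.fwd <;> intro hfg
      · simp only [Bool.false_eq_true, ↓reduceIte] at hfg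
        have eZ : Z = g * (star (1 + pertVar U₀ U s.bond) - 1) * star g := by
          rw [hZ, hfg, mul_sub, sub_mul, mul_one, hgg]
        rw [eZ]
        exact (norm_conj_stepFactor_le U₀ s _).trans (le_of_eq (norm_star_one_add_pertVar_sub_one U₀ U s.bond))
      · simp only [↓reduceIte] at hfg
        have eZ : Z = pertVar U₀ U s.bond := by rw [hZ, hfg, add_sub_cancel_left]
        rw [eZ]
    -- the recursion `D' = Z + g D g* + Z g D g*`
    have hF' : ((holAt U (s :: γ) : Matrix.specialUnitaryGroup n ℂ) : Matrix n n ℂ) = f * F := by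
      rw [coe_holAt_eq_prod_stepFactor, List.map_cons, List.prod_cons, ← coe_holAt_eq_prod_stepFactor]
    have hF₀' : ((holAt U₀ (s :: γ) : Matrix.specialUnitaryGroup n ℂ) : Matrix n n ℂ) = g * F₀ := by
      rw [coe_holAt_eq_prod_stepFactor, List.map_cons, List.prod_cons, ← coe_holAt_eq_prod_stepFactor]
    have erec : f * F * star (g * F₀) - 1 = Z + g * D * star g + Z * (g * D * star g) := by
      rw [star_mul, hZ, hD]
      have e1 : (f * star g - 1) * (g * (F * star F₀ - 1) * star g) =
          f * (star g * g) * (F * star F₀ - 1) * star g - g * (F * star F₀ - 1) * star g := by noncomm_ring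
      rw [e1, hgg', mul_one]
      noncomm_ring
    rw [hF', hF₀', List.length_cons, List.map_cons, List.sum_cons, erec]
    have hconj : ‖g * D * star g‖ ≤ ‖D‖ := norm_conj_stepFactor_le U₀ s D
    have hp : (1 : ℝ) ≤ (1 + δ) ^ γ.length := one_le_pow₀ (by linarith)
    have hS0 : 0 ≤ S := by
      rw [hS]; exact List.sum_nonneg (fun x hx => by obtain ⟨s', _, rfl⟩ := List.mem_map.1 hx; exact norm_nonneg _)
    have hy0 : 0 ≤ ‖pertVar U₀ U s.bond‖ := norm_nonneg _
    have hDp : ‖D‖ ≤ (1 + δ) ^ γ.length - 1 := ih₀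
    have hDS : ‖D‖ ≤ (1 + δ) ^ γ.length * S := ih
    calc ‖Z + g * D * star g + Z * (g * D * star g)‖ ≤ ‖Z‖ + ‖g * D * star g‖ + ‖Z‖ * ‖g * D * star g‖ :=
          (norm_add_le _ _).trans (add_le_add (norm_add_le _ _) (norm_mul_le _ _))
      _ ≤ ‖pertVar U₀ U s.bond‖ + (1 + δ) ^ γ.length * S + ‖pertVar U₀ U s.bond‖ * ((1 + δ) ^ γ.length - 1) := by
          have a1 := hconj.trans hDS
          have a2 := hconj.trans hDp
          have a3 : ‖Z‖ * ‖g * D * star g‖ ≤ ‖pertVar U₀ U s.bond‖ * ((1 + δ) ^ γ.length - 1) :=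
            mul_le_mul hZle a2 (norm_nonneg _) hy0
          linarith
      _ = (1 + δ) ^ γ.length * (‖pertVar U₀ U s.bond‖ + S) := by ring
      _ ≤ (1 + δ) ^ (γ.length + 1) * (‖pertVar U₀ U s.bond‖ + S) := by
          have hq : (1 + δ) ^ γ.length ≤ (1 + δ) ^ (γ.length + 1) := by
            rw [pow_succ]
            exact le_mul_of_one_le_right (by positivity) (by linarith)
          exact mul_le_mul_of_nonneg_right hq (add_nonneg hy0 hS0)

end Summit.QuantumFields.YangMills.Theorems.Prop7HolRatioWalkSum

end
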